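import Mathlib
import HarnessLib
import Summits.HubbardSuperconductivity.HubbardSuperconductivity.Theorems.KLProgrammeMatsubaraZeroSound

/-!
# Route `KLProgramme` — crux K3 split, ENGINE child (`stub_engine_step`'s (T) clause): the discrete zero-sound bubble in the CARRIER'S OWN
# VARIABLES — a shell weight `F(t²)` supported in an annulus `r₁² < t² < r₂²` against the propagator square `(−ik₀ + e)^{−2}`
# (cell gate-hubbard-kl, seat hubbard-kl-k3c2-p2 «thermal-bar induction n ≤ nScales β + 1»)

`…MatsubaraZeroSound` (p456569) states the discrete bubble for the singularity-free form `G(s)(ik₀+e)²`; the engine's slice integrand is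
`F(k₀² + e²)·(−ik₀ + e)^{−2}` with `F(s) = [χ₂(s/Λ_n²) − χ₂(s/Λ_{n−1}²)]·[…]` (product of two slice weights of `hubbardCutoffWeightCT`, a function
of `s = t² = k₀² + e_K²`), supported in the annulus `Λ_n²/4 < s < Λ_{n−1}²` (k3c2-p3's `klld_slice_support`), Lipschitz in `s`, bounded by `1`.
This module is the bridge: `G := F/s²` is `(L_F/r₁⁴ + 2M_F/r₁⁶)`-Lipschitz and vanishes for `s ≥ r₂²` (`klza_div_sq_lipschitz`, `klza_div_sq_zero`),
the integrands agree pointwise (`klzd_integrand_eq`), hence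
**`klza_discrete_zeroSound_bubble_norm_le`**: for `F : ℝ → ℂ` `L_F`-Lipschitz, `‖F‖ ≤ M_F`, `F(s) = 0` for `s ≤ r₁²` and for `s ≥ r₂²`
(`0 < r₁ ≤ r₂`), `β > 0`, `M ≥ βr₂/(2π) + 1`:
`‖β⁻¹ • Σ_{i : MatsubaraIdx M} ∫ F(ω_i² + e²)·((−iω_i + e)²)⁻¹ de‖ ≤ 8·(L_F/r₁⁴ + 2M_F/r₁⁶)·r₂⁴·(r₂ + 2π/β)/β`.
At scale `n`: `r₁ = Λ_n/2`, `r₂ = Λ_{n−1} = 4Λ_n`, `L_F ≲ sup|χ₂′|/Λ_n²`, `M_F ≤ 1` ⇒ `≍ (βΛ_n)^{−1} ≍ (π/β)/Λ_n ≤ 4^{−(n_β−n)}` (`…SplitThermalLayer`).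
Pure analysis; nothing about the model is asserted.
-/

noncomputable section

namespace Summit.HubbardSuperconductivity.HubbardSuperconductivity.Theorems.KLRegimeSplit

set_option linter.dupNamespace false -- summit = problem name (single-conjunct summit), D-0017

open Real Finset MeasureTheory Complex Literature.MathematicalPhysics.QuantumLattice
open Summit.HubbardSuperconductivity.HubbardSuperconductivity.Theorems

section Annulus

variable {F : ℝ → ℂ} {LF MF r₁ r₂ : ℝ}

/-- `F/s²` vanishes where `F` does (in particular for `s ≥ r₂²`). -/
theorem klza_div_sq_zero (hzero : ∀ s, r₂ ^ 2 ≤ s → F s = 0) (s : ℝ) (hs : r₂ ^ 2 ≤ s) :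
    (fun s : ℝ => F s / ((s : ℝ) : ℂ) ^ 2) s = 0 := by
  simp only [hzero s hs, zero_div]

/-- **`G = F/s²` is Lipschitz** with constant `L_F/r₁⁴ + 2M_F/r₁⁶` when `F` is `L_F`-Lipschitz, bounded by `M_F`, and vanishes for `s ≤ r₁²`
(`r₁ > 0`). -/
theorem klza_div_sq_lipschitz (hlip : ∀ s s', ‖F s - F s'‖ ≤ LF * |s - s'|) (hbd : ∀ s, ‖F s‖ ≤ MF)
    (hin : ∀ s, s ≤ r₁ ^ 2 → F s = 0) (hr₁ : 0 < r₁) (s s' : ℝ) :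
    ‖F s / ((s : ℝ) : ℂ) ^ 2 - F s' / ((s' : ℝ) : ℂ) ^ 2‖ ≤ (LF / r₁ ^ 4 + 2 * MF / r₁ ^ 6) * |s - s'| := by
  have hLF : 0 ≤ LF := by
    have := hlip 0 1; have h0 : (0:ℝ) ≤ ‖F 0 - F 1‖ := norm_nonneg _; norm_num at this; linarith
  have hMF : 0 ≤ MF := (norm_nonneg _).trans (hbd 0)
  have hr4 : 0 < r₁ ^ 4 := by positivity
  have hr6 : 0 < r₁ ^ 6 := by positivity
  -- norm of the real square as a complex number
  have hnsq : ∀ t : ℝ, ‖((t : ℝ) : ℂ) ^ 2‖ = t ^ 2 := fun t => by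
    rw [norm_pow, Complex.norm_real, Real.norm_eq_abs, sq_abs]
  -- the one-sided estimate: `s` in the support region, `s'` anywhere
  -- Case analysis on `s ≤ r₁²`, `s' ≤ r₁²`.
  by_cases hs : s ≤ r₁ ^ 2 <;> by_cases hs' : s' ≤ r₁ ^ 2
  · rw [hin s hs, hin s' hs', zero_div, zero_div, sub_zero, norm_zero]; positivity
  · -- `s` inside (F s = 0), `s'` outside
    push Not at hs'
    rw [hin s hs, zero_div, zero_sub, norm_neg, norm_div, hnsq]
    have h1 : ‖F s'‖ ≤ LF * (s' - s) := by
      have := hlip s' s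
      rw [hin s hs, sub_zero] at this
      rwa [abs_of_pos (by linarith)] at this
    have hs'0 : 0 < s' := lt_of_lt_of_le (by positivity) hs'.le
    have hs'pos : 0 < s' ^ 2 := by positivity
    rw [div_le_iff₀ hs'pos]
    have h2 : r₁ ^ 4 ≤ s' ^ 2 := by nlinarith
    have h3 : |s - s'| = s' - s := by rw [abs_sub_comm, abs_of_pos (by linarith)]
    rw [h3]
    have h4 : LF * (s' - s) ≤ LF / r₁ ^ 4 * (s' - s) * s' ^ 2 := by
      rw [div_mul_eq_mul_div, div_mul_eq_mul_div, le_div_iff₀ hr4]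
      have : 0 ≤ LF * (s' - s) := by nlinarith
      nlinarith
    have h5 : 0 ≤ 2 * MF / r₁ ^ 6 * (s' - s) * s' ^ 2 := by
      have : 0 ≤ s' - s := by linarith
      positivity
    nlinarith
  · -- `s` outside, `s'` inside (F s' = 0)
    push Not at hs
    rw [hin s' hs', zero_div, sub_zero, norm_div, hnsq]
    have h1 : ‖F s‖ ≤ LF * (s - s') := by
      have := hlip s s'
      rw [hin s' hs', sub_zero] at this
      rwa [abs_of_pos (by linarith)] at this
    have hs0 : 0 < s := lt_of_lt_of_le (by positivity) hs.le
    have hspos : 0 < s ^ 2 := by positivity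
    rw [div_le_iff₀ hspos]
    have h2 : r₁ ^ 4 ≤ s ^ 2 := by nlinarith
    have h3 : |s - s'| = s - s' := abs_of_pos (by linarith)
    rw [h3]
    have h4 : LF * (s - s') ≤ LF / r₁ ^ 4 * (s - s') * s ^ 2 := by
      rw [div_mul_eq_mul_div, div_mul_eq_mul_div, le_div_iff₀ hr4]
      have : 0 ≤ LF * (s - s') := by nlinarith
      nlinarith
    have h5 : 0 ≤ 2 * MF / r₁ ^ 6 * (s - s') * s ^ 2 := by
      have : 0 ≤ s - s' := by linarith
      positivity
    nlinarith
  · -- both outside: the quotient rule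
    push Not at hs hs'
    have hs0 : 0 < s := lt_of_lt_of_le (by positivity) hs.le
    have hs0' : 0 < s' := lt_of_lt_of_le (by positivity) hs'.le
    have hsC : ((s : ℝ) : ℂ) ^ 2 ≠ 0 := pow_ne_zero 2 (Complex.ofReal_ne_zero.mpr hs0.ne')
    have hsC' : ((s' : ℝ) : ℂ) ^ 2 ≠ 0 := pow_ne_zero 2 (Complex.ofReal_ne_zero.mpr hs0'.ne')
    -- F s/s² − F s'/s'² = (F s − F s')/s² + F s'·(1/s² − 1/s'²)
    have hsplit : F s / ((s : ℝ) : ℂ) ^ 2 - F s' / ((s' : ℝ) : ℂ) ^ 2 =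
        (F s - F s') / ((s : ℝ) : ℂ) ^ 2 + F s' * ((((s : ℝ) : ℂ) ^ 2)⁻¹ - (((s' : ℝ) : ℂ) ^ 2)⁻¹) := by
      field_simp
      ring
    rw [hsplit]
    have hA : ‖(F s - F s') / ((s : ℝ) : ℂ) ^ 2‖ ≤ LF / r₁ ^ 4 * |s - s'| := by
      rw [norm_div, hnsq, div_le_iff₀ (by positivity)]
      have h2 : r₁ ^ 4 ≤ s ^ 2 := by nlinarith
      calc ‖F s - F s'‖ ≤ LF * |s - s'| := hlip s s'
        _ = LF / r₁ ^ 4 * |s - s'| * r₁ ^ 4 := by field_simp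
        _ ≤ LF / r₁ ^ 4 * |s - s'| * s ^ 2 := by gcongr
    have hB : ‖F s' * ((((s : ℝ) : ℂ) ^ 2)⁻¹ - (((s' : ℝ) : ℂ) ^ 2)⁻¹)‖ ≤ 2 * MF / r₁ ^ 6 * |s - s'| := by
      rw [norm_mul]
      -- `|1/s² − 1/s'²| = |s − s'|(s + s')/(s² s'²) ≤ 2|s − s'|/r₁⁶`
      have hinv : (((s : ℝ) : ℂ) ^ 2)⁻¹ - (((s' : ℝ) : ℂ) ^ 2)⁻¹ = (((s' ^ 2 - s ^ 2) / (s ^ 2 * s' ^ 2) : ℝ) : ℂ) := by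
        rw [inv_sub_inv hsC hsC']
        push_cast
        ring
      rw [hinv, Complex.norm_real, Real.norm_eq_abs, abs_div, abs_of_pos (by positivity : 0 < s ^ 2 * s' ^ 2)]
      have hfac : |s' ^ 2 - s ^ 2| = |s - s'| * (s + s') := by
        rw [show s' ^ 2 - s ^ 2 = -((s - s') * (s + s')) by ring, abs_neg, abs_mul, abs_of_pos (by linarith : 0 < s + s')]
      rw [hfac]
      have hkey : (s + s') / (s ^ 2 * s' ^ 2) ≤ 2 / r₁ ^ 6 := by
        rw [div_le_div_iff₀ (by positivity) hr6]
        -- `(s + s') r₁⁶ ≤ 2 s² s'²`: from `r₁² ≤ s, s'`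
        have ha : r₁ ^ 2 ≤ s := hs.le
        have hb : r₁ ^ 2 ≤ s' := hs'.le
        have hr2 : 0 ≤ r₁ ^ 2 := by positivity
        have h1 : r₁ ^ 6 ≤ s * s' ^ 2 := by
          calc r₁ ^ 6 = r₁ ^ 2 * (r₁ ^ 2 * r₁ ^ 2) := by ring
            _ ≤ s * (s' * s') := mul_le_mul ha (mul_le_mul hb hb hr2 hs0'.le) (by positivity) hs0.le
            _ = s * s' ^ 2 := by ring
        have h2 : r₁ ^ 6 ≤ s ^ 2 * s' := by
          calc r₁ ^ 6 = (r₁ ^ 2 * r₁ ^ 2) * r₁ ^ 2 := by ring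
            _ ≤ (s * s) * s' := mul_le_mul (mul_le_mul ha ha hr2 hs0.le) hb hr2 (by positivity)
            _ = s ^ 2 * s' := by ring
        nlinarith [mul_le_mul_of_nonneg_left h1 hs0.le, mul_le_mul_of_nonneg_left h2 hs0'.le]
      calc ‖F s'‖ * (|s - s'| * (s + s') / (s ^ 2 * s' ^ 2)) ≤ MF * (|s - s'| * (2 / r₁ ^ 6)) := by
            rw [mul_div_assoc]
            exact mul_le_mul (hbd s') (mul_le_mul_of_nonneg_left hkey (abs_nonneg _)) (by positivity) hMF
        _ = 2 * MF / r₁ ^ 6 * |s - s'| := by ring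
    calc _ ≤ ‖(F s - F s') / ((s : ℝ) : ℂ) ^ 2‖ + ‖F s' * ((((s : ℝ) : ℂ) ^ 2)⁻¹ - (((s' : ℝ) : ℂ) ^ 2)⁻¹)‖ := norm_add_le _ _
      _ ≤ LF / r₁ ^ 4 * |s - s'| + 2 * MF / r₁ ^ 6 * |s - s'| := add_le_add hA hB
      _ = (LF / r₁ ^ 4 + 2 * MF / r₁ ^ 6) * |s - s'| := by ring

/-- **The discrete zero-sound bubble in the carrier's variables.**  For a shell weight `F : ℝ → ℂ` (`L_F`-Lipschitz in `s = t²`, `‖F‖ ≤ M_F`,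
`F(s) = 0` for `s ≤ r₁²` and for `s ≥ r₂²`, `0 < r₁`, `0 < r₂`), `β > 0` and every Matsubara cutoff `M ≥ βr₂/(2π) + 1`:
`‖β⁻¹ • Σ_{i : MatsubaraIdx M} ∫ F(ω_i² + e²)·((−iω_i + e)²)⁻¹ de‖ ≤ 8·(L_F/r₁⁴ + 2M_F/r₁⁶)·r₂⁴·(r₂ + 2π/β)/β`. -/
theorem klza_discrete_zeroSound_bubble_norm_le (hlip : ∀ s s', ‖F s - F s'‖ ≤ LF * |s - s'|) (hbd : ∀ s, ‖F s‖ ≤ MF)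
    (hin : ∀ s, s ≤ r₁ ^ 2 → F s = 0) (hout : ∀ s, r₂ ^ 2 ≤ s → F s = 0) (hr₁ : 0 < r₁) (hr₂ : 0 < r₂)
    {β : ℝ} (hβ : 0 < β) {M : ℕ} (hM : β * r₂ / (2 * Real.pi) + 1 ≤ M) :
    ‖β⁻¹ • ∑ i : MatsubaraIdx M,
        ∫ e : ℝ, F (matsubaraFreq β M i ^ 2 + e ^ 2) * ((-I * (matsubaraFreq β M i) + e) ^ 2)⁻¹‖ ≤
      8 * (LF / r₁ ^ 4 + 2 * MF / r₁ ^ 6) * r₂ ^ 4 * (r₂ + 2 * Real.pi / β) / β := by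
  -- pass to the singularity-free form `G(s)(ik₀+e)²`, `G = F/s²`
  set G : ℝ → ℂ := fun s => F s / ((s : ℝ) : ℂ) ^ 2 with hG
  have hGlip : ∀ s s', ‖G s - G s'‖ ≤ (LF / r₁ ^ 4 + 2 * MF / r₁ ^ 6) * |s - s'| := fun s s' =>
    klza_div_sq_lipschitz hlip hbd hin hr₁ s s'
  have hGsupp : ∀ s, r₂ ^ 2 ≤ s → G s = 0 := fun s hs => by simp only [hG, hout s hs, zero_div]
  have hconv : ∀ (k₀ e : ℝ), F (k₀ ^ 2 + e ^ 2) * ((-I * k₀ + e) ^ 2)⁻¹ = G (k₀ ^ 2 + e ^ 2) * (I * k₀ + e) ^ 2 := by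
    intro k₀ e
    rw [klzd_integrand_eq G k₀ e]
    congr 1
    simp only [hG]
    by_cases hz : ((k₀ ^ 2 + e ^ 2 : ℝ) : ℂ) = 0
    · have hz' : k₀ ^ 2 + e ^ 2 = 0 := by exact_mod_cast hz
      have hk : k₀ = 0 := by nlinarith [sq_nonneg k₀, sq_nonneg e]
      have he : e = 0 := by nlinarith [sq_nonneg k₀, sq_nonneg e]
      subst hk; subst he
      have : F 0 = 0 := hin 0 (by positivity)
      simp [this]
    · field_simp
  simp_rw [hconv]
  exact klzd_discrete_zeroSound_bubble_norm_le hGlip hGsupp hr₂ hβ hM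

end Annulus

end Summit.HubbardSuperconductivity.HubbardSuperconductivity.Theorems.KLRegimeSplit

end
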